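import Mathlib
import Summits.CriticalPhenomena.SAWScalingLimit.Theorems.SAWDefectDecoherenceSectorSlavingDefs
import Summits.CriticalPhenomena.SAWScalingLimit.Theorems.SAWDefectDecoherenceDefectDecoherenceTmStarSums
import HarnessLib

/-!
# The slaving induction (stub `stub_defectSlaving` of the line `sector-slaving`,
crux `DefectDecoherence`, stmt-CriticalPhenomena-8549)

The clean defect sector `A_D = cleanDefect` is algebraically slaved to its sources.  At a `2`-deep
vertex `v` the exact `D`-row `Ā_D(v) = rowD(v)` distributes as
`A_D(v) = (1/3)·unstableSource(v) + (c_S/3)·signalSource(v) + (c_D/3)·Σ_{t ∼ v} A_D(t) - dressedDefect(v)`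
with `c_D/3 = 2x_c cos(13π/24)/3 = -q/3`, `q = slavingCoupling = 2x_c sin(π/24)`, `|c_S/3| ≤ 1`
(`slave_rowD_split`, `slave_one_step`).  Given decay of the three sources at a rate `θ' > 3/4`
(the minimum of the three rates), the neighbour star-mass bound `Σ_{t ∼ v} M(t) ≤ c M(v)` with
`κ = qc/3 < 1` and the a-priori bound `‖A_D‖ ≤ M/2`, an induction on unit depth layers
(a neighbour of an `R`-deep vertex is `(R-1)`-deep, `slave_deep_of_adj`) gives
`‖A_D(v)‖ ≤ K R^{-θ'} M(v)`: below an explicit threshold `R₀` (`slave_ratio`: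
`κ (R-1)^{-θ'} ≤ ((1+κ)/2) R^{-θ'}` for `R ≥ R₀`) the a-priori bound suffices
(`slave_threshold_const`), above it one step of the row contracts
(`C' + K(1+κ)/2 ≤ K` for `K ≥ 2C'/(1-κ)`).  Elementary real analysis; no walk combinatorics.

Sources: H. Duminil-Copin, S. Smirnov, Ann. of Math. 175 (2012) (arXiv:1007.0575), §2; the line
card `Lines/sector-slaving.md` of the crux.
-/

noncomputable section

open scoped BigOperators ComplexConjugate Classical
open Literature.Probability.LatticeModels Literature.Probability.RandomPlanarGeometry.SAW
open Summit.CriticalPhenomena.SAWScalingLimit.Theorems.DefectDecoherence.TipMartingale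

namespace Summit.CriticalPhenomena.SAWScalingLimit.Theorems.DefectDecoherence.SectorSlaving

/-! ### Constants of the `D`-row -/

/-- `cos(13π/24) = -sin(π/24)`: the diagonal coefficient of the `D`-row is `-q/3`,
`q = slavingCoupling`. [folklore] -/
theorem slave_diag_coeff : 2 * xc * Real.cos (13 * Real.pi / 24) / 3 = -(slavingCoupling / 3) := by
  have h : Real.cos (13 * Real.pi / 24) = -Real.sin (Real.pi / 24) := by
    rw [show 13 * Real.pi / 24 = Real.pi / 24 + Real.pi / 2 by ring, Real.cos_add_pi_div_two]
  rw [h, slavingCoupling]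
  ring

/-- `0 ≤ q = 2 x_c sin(π/24)`. [folklore] -/
theorem slave_coupling_nonneg : 0 ≤ slavingCoupling := by
  unfold slavingCoupling
  have h1 : 0 ≤ Real.sin (Real.pi / 24) :=
    Real.sin_nonneg_of_nonneg_of_le_pi (by positivity) (by linarith [Real.pi_pos])
  have h2 : 0 ≤ xc := hexCriticalFugacity_pos_lt_one.1.le
  positivity

/-- `|2 x_c cos(5π/24)/3| ≤ 1` (`0 < x_c < 1`). [folklore] -/
theorem slave_signal_coeff_abs_le : |2 * xc * Real.cos (5 * Real.pi / 24) / 3| ≤ 1 := by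
  have h0 : 0 < xc := hexCriticalFugacity_pos_lt_one.1
  have h1 : xc < 1 := hexCriticalFugacity_pos_lt_one.2
  have hc : |Real.cos (5 * Real.pi / 24)| ≤ 1 := Real.abs_cos_le_one _
  rw [abs_div, abs_mul, abs_mul, abs_of_pos h0, abs_of_pos (by norm_num : (0 : ℝ) < 2),
    abs_of_pos (by norm_num : (0 : ℝ) < 3), div_le_one (by norm_num : (0 : ℝ) < 3)]
  nlinarith [abs_nonneg (Real.cos (5 * Real.pi / 24))]

/-! ### One step of the row -/

/-- The `D`-row distributes into its three sources:
`rowD = (1/3)·unstableSource + (c_S/3)·signalSource + (c_D/3)·Σ_{t ∼ v} A_D(t)`. [folklore] -/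
theorem slave_rowD_split (Λ : Finset HexVertex) (u w v : HexVertex) :
    rowD Λ u w v = (1 / 3 : ℂ) * unstableSource Λ u w v +
      ((2 * xc * Real.cos (5 * Real.pi / 24) / 3 : ℝ) : ℂ) * signalSource Λ u w v +
      ((2 * xc * Real.cos (13 * Real.pi / 24) / 3 : ℝ) : ℂ) *
        ∑ t ∈ star Λ v, cleanDefect Λ u w t := by
  simp only [rowD, unstableSource, signalSource, cleanDefect, Finset.mul_sum,
    ← Finset.sum_add_distrib, mul_assoc]

/-- ONE STEP of the slaving: at a vertex `v` where the exact `D`-row `Ā_D(v) = rowD(v)` holds,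
`‖A_D(v)‖ ≤ (1/3)‖unstableSource(v)‖ + ‖signalSource(v)‖ + ‖dressedDefect(v)‖ + (q/3) Σ_{t ∼ v} ‖A_D(t)‖`
(triangle inequality; `A_D = Ā_D - (Ā_D - A_D)`). [folklore] -/
theorem slave_one_step {Λ : Finset HexVertex} {u w v : HexVertex}
    (hrow : viaSum Λ s(u, w) (rootAngle u w) (13 / 8) v = rowD Λ u w v) :
    ‖cleanDefect Λ u w v‖ ≤ 1 / 3 * ‖unstableSource Λ u w v‖ + ‖signalSource Λ u w v‖ +
      ‖dressedDefect Λ u w v‖ + slavingCoupling / 3 * ∑ t ∈ star Λ v, ‖cleanDefect Λ u w t‖ := by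
  have hq3 : 0 ≤ slavingCoupling / 3 := div_nonneg slave_coupling_nonneg (by norm_num)
  have hA : cleanDefect Λ u w v =
      (1 / 3 : ℂ) * unstableSource Λ u w v +
        ((2 * xc * Real.cos (5 * Real.pi / 24) / 3 : ℝ) : ℂ) * signalSource Λ u w v +
        ((2 * xc * Real.cos (13 * Real.pi / 24) / 3 : ℝ) : ℂ) *
          (∑ t ∈ star Λ v, cleanDefect Λ u w t) - dressedDefect Λ u w v := by
    rw [← slave_rowD_split, ← hrow]
    unfold cleanDefect dressedDefect
    ring
  have h1 : ‖(1 / 3 : ℂ) * unstableSource Λ u w v‖ = 1 / 3 * ‖unstableSource Λ u w v‖ := by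
    rw [norm_mul]
    norm_num
  have h2 : ‖((2 * xc * Real.cos (5 * Real.pi / 24) / 3 : ℝ) : ℂ) * signalSource Λ u w v‖ ≤
      ‖signalSource Λ u w v‖ := by
    rw [norm_mul, Complex.norm_real, Real.norm_eq_abs]
    calc |2 * xc * Real.cos (5 * Real.pi / 24) / 3| * ‖signalSource Λ u w v‖
        ≤ 1 * ‖signalSource Λ u w v‖ :=
          mul_le_mul_of_nonneg_right slave_signal_coeff_abs_le (norm_nonneg _)
      _ = ‖signalSource Λ u w v‖ := one_mul _
  have h3 : ‖((2 * xc * Real.cos (13 * Real.pi / 24) / 3 : ℝ) : ℂ) *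
        ∑ t ∈ star Λ v, cleanDefect Λ u w t‖ ≤
      slavingCoupling / 3 * ∑ t ∈ star Λ v, ‖cleanDefect Λ u w t‖ := by
    rw [norm_mul, Complex.norm_real, Real.norm_eq_abs, slave_diag_coeff, abs_neg, abs_of_nonneg hq3]
    exact mul_le_mul_of_nonneg_left (norm_sum_le _ _) hq3
  rw [hA]
  calc ‖(1 / 3 : ℂ) * unstableSource Λ u w v +
          ((2 * xc * Real.cos (5 * Real.pi / 24) / 3 : ℝ) : ℂ) * signalSource Λ u w v +
          ((2 * xc * Real.cos (13 * Real.pi / 24) / 3 : ℝ) : ℂ) *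
            (∑ t ∈ star Λ v, cleanDefect Λ u w t) - dressedDefect Λ u w v‖
      ≤ ‖(1 / 3 : ℂ) * unstableSource Λ u w v +
          ((2 * xc * Real.cos (5 * Real.pi / 24) / 3 : ℝ) : ℂ) * signalSource Λ u w v +
          ((2 * xc * Real.cos (13 * Real.pi / 24) / 3 : ℝ) : ℂ) *
            (∑ t ∈ star Λ v, cleanDefect Λ u w t)‖ + ‖dressedDefect Λ u w v‖ := norm_sub_le _ _
    _ ≤ ‖(1 / 3 : ℂ) * unstableSource Λ u w v‖ +
          ‖((2 * xc * Real.cos (5 * Real.pi / 24) / 3 : ℝ) : ℂ) * signalSource Λ u w v‖ +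
          ‖((2 * xc * Real.cos (13 * Real.pi / 24) / 3 : ℝ) : ℂ) *
            (∑ t ∈ star Λ v, cleanDefect Λ u w t)‖ + ‖dressedDefect Λ u w v‖ :=
        add_le_add norm_add₃_le le_rfl
    _ ≤ 1 / 3 * ‖unstableSource Λ u w v‖ + ‖signalSource Λ u w v‖ +
          ‖dressedDefect Λ u w v‖ + slavingCoupling / 3 * ∑ t ∈ star Λ v, ‖cleanDefect Λ u w t‖ := by
        rw [h1]
        linarith

/-! ### Depth bookkeeping and the two real-variable inequalities -/

/-- A neighbour of an `R`-deep vertex is `(R-1)`-deep (adjacent centres are at distance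
`1/√3 ≤ 1`). [folklore] -/
theorem slave_deep_of_adj {Λ : Finset HexVertex} {v t : HexVertex} {R : ℝ} (hdeep : Deep Λ v R)
    (h : hexGraph.Adj v t) : Deep Λ t (R - 1) := by
  intro y hy
  refine hdeep y ?_
  calc dist (hexCenter y) (hexCenter v)
      ≤ dist (hexCenter y) (hexCenter t) + dist (hexCenter t) (hexCenter v) := dist_triangle _ _ _
    _ ≤ (R - 1) + 1 := add_le_add hy (dist_hexCenter_le_one_of_adj h.symm)
    _ = R := by ring

/-- The contraction absorbs one unit layer: for `0 < κ < 1` and `0 < θ` there is an explicit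
threshold `R₀ ≥ 2` with `κ (R-1)^{-θ} ≤ ((1+κ)/2) R^{-θ}` for all `R ≥ R₀`
(`R₀ = max 2 (1 + 1/(σ-1))`, `σ = ((1+κ)/(2κ))^{1/θ} > 1`). [folklore] -/
theorem slave_ratio {κ θ : ℝ} (hκ0 : 0 < κ) (hκ1 : κ < 1) (hθ : 0 < θ) :
    ∃ R₀ : ℝ, 2 ≤ R₀ ∧ ∀ R : ℝ, R₀ ≤ R → κ * (R - 1) ^ (-θ) ≤ (1 + κ) / 2 * R ^ (-θ) := by
  set ρ : ℝ := (1 + κ) / (2 * κ) with hρdef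
  have hκne : κ ≠ 0 := hκ0.ne'
  have hρ : 1 < ρ := by
    rw [hρdef, lt_div_iff₀ (by positivity)]
    linarith
  have hρ0 : 0 ≤ ρ := zero_le_one.trans hρ.le
  set σ : ℝ := ρ ^ θ⁻¹ with hσdef
  have hσ : 1 < σ := Real.one_lt_rpow hρ (inv_pos.2 hθ)
  have hσθ : σ ^ θ = ρ := Real.rpow_inv_rpow hρ0 hθ.ne'
  have hσ1 : 0 < σ - 1 := by linarith
  refine ⟨max 2 (1 + 1 / (σ - 1)), le_max_left _ _, fun R hR => ?_⟩
  have hR2 : 2 ≤ R := (le_max_left _ _).trans hR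
  have hR1 : 1 / (σ - 1) ≤ R - 1 := by linarith [(le_max_right _ _).trans hR]
  have hR0 : 0 < R := by linarith
  have hRm : 0 < R - 1 := by linarith
  have hinv : 1 / (R - 1) ≤ σ - 1 := by
    rw [div_le_iff₀ hRm]
    calc (1 : ℝ) = (σ - 1) * (1 / (σ - 1)) := (mul_one_div_cancel hσ1.ne').symm
      _ ≤ (σ - 1) * (R - 1) := mul_le_mul_of_nonneg_left hR1 hσ1.le
  have hquot : R / (R - 1) ≤ σ := by
    have h : R / (R - 1) = 1 + 1 / (R - 1) := by
      rw [one_add_div hRm.ne', sub_add_cancel]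
    rw [h]
    linarith
  have hpow : (R / (R - 1)) ^ θ ≤ ρ := by
    rw [← hσθ]
    exact Real.rpow_le_rpow (div_nonneg hR0.le hRm.le) hquot hθ.le
  have hsplit : (R - 1) ^ (-θ) = (R / (R - 1)) ^ θ * R ^ (-θ) := by
    rw [Real.div_rpow hR0.le hRm.le, Real.rpow_neg hR0.le, Real.rpow_neg hRm.le]
    have h1 : R ^ θ ≠ 0 := (Real.rpow_pos_of_pos hR0 θ).ne'
    have h2 : (R - 1) ^ θ ≠ 0 := (Real.rpow_pos_of_pos hRm θ).ne'
    field_simp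
  rw [hsplit]
  have hRθ : 0 ≤ R ^ (-θ) := Real.rpow_nonneg hR0.le _
  calc κ * ((R / (R - 1)) ^ θ * R ^ (-θ)) = κ * (R / (R - 1)) ^ θ * R ^ (-θ) := by ring
    _ ≤ κ * ρ * R ^ (-θ) :=
        mul_le_mul_of_nonneg_right (mul_le_mul_of_nonneg_left hpow hκ0.le) hRθ
    _ = (1 + κ) / 2 * R ^ (-θ) := by
        congr 1
        rw [hρdef]
        field_simp

/-- Below the threshold the a-priori bound suffices: `1/2 ≤ (R₀^θ/2)·R^{-θ}` for `1 ≤ R ≤ R₀`,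
`0 < θ`. [folklore] -/
theorem slave_threshold_const {θ R R₀ : ℝ} (hθ : 0 < θ) (hR : 1 ≤ R) (hRR : R ≤ R₀) :
    (1 / 2 : ℝ) ≤ R₀ ^ θ / 2 * R ^ (-θ) := by
  have hR0 : 0 < R := by linarith
  have hR₀ : 0 < R₀ := by linarith
  have hmono : R₀ ^ (-θ) ≤ R ^ (-θ) := Real.rpow_le_rpow_of_nonpos hR0 hRR (by linarith)
  have hone : R₀ ^ θ * R₀ ^ (-θ) = 1 := by
    rw [Real.rpow_neg hR₀.le, mul_inv_cancel₀ (Real.rpow_pos_of_pos hR₀ θ).ne']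
  have hpos : 0 ≤ R₀ ^ θ / 2 := by positivity
  calc (1 / 2 : ℝ) = R₀ ^ θ / 2 * R₀ ^ (-θ) := by rw [div_mul_eq_mul_div, hone]
    _ ≤ R₀ ^ θ / 2 * R ^ (-θ) := mul_le_mul_of_nonneg_left hmono hpos

/-- A source bound at rate `θ` is a bound at any smaller rate `θ' ≤ θ` with constant `|C|`
(`R ≥ 1`). [folklore] -/
theorem slave_source_mono {x : ℂ} {C θ θ' R M : ℝ} (hR : 1 ≤ R) (hθ : θ' ≤ θ) (hM : 0 ≤ M)
    (h : ‖x‖ ≤ C * R ^ (-θ) * M) : ‖x‖ ≤ |C| * R ^ (-θ') * M := by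
  have hR0 : 0 ≤ R := zero_le_one.trans hR
  have hmono : R ^ (-θ) ≤ R ^ (-θ') := Real.rpow_le_rpow_of_exponent_le hR (neg_le_neg hθ)
  calc ‖x‖ ≤ C * R ^ (-θ) * M := h
    _ ≤ |C| * R ^ (-θ) * M :=
        mul_le_mul_of_nonneg_right
          (mul_le_mul_of_nonneg_right (le_abs_self _) (Real.rpow_nonneg hR0 _)) hM
    _ ≤ |C| * R ^ (-θ') * M :=
        mul_le_mul_of_nonneg_right (mul_le_mul_of_nonneg_left hmono (abs_nonneg _)) hM

/-! ### The slaving induction -/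

/-- **Stub 7/7 of the line `sector-slaving` — the slaving induction** (discrete maximum principle on
the depth).  From the exact `D`-row at `2`-deep vertices, the a-priori bound `‖A_ξ‖ ≤ M/2`, the
neighbour star-mass bound with `c·q < 3`, and decay at rates `> 3/4` of the two free-sector sources
and of the loop-dressed defect, the clean defect sector decays at the rate `min θᵢ > 3/4`:
induction on unit depth layers, each inward step buying the contraction `qc/3 < 1`. [folklore] -/
theorem stub_defectSlaving :
    (∀ (Λ : Finset HexVertex) (u w : HexVertex), hexGraph.Adj u w → u ∉ Λ → w ∈ Λ →
        ∀ v : HexVertex, Deep Λ v 2 → viaSum Λ s(u, w) (rootAngle u w) (13 / 8) v = rowD Λ u w v) →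
      AprioriArrivalBound (1 / 2) →
      (∃ c : ℝ, c * slavingCoupling < 3 ∧ NeighbourMassBound c) →
      (∃ C θ : ℝ, 3 / 4 < θ ∧ DecayBound unstableSource C θ) →
      (∃ C θ : ℝ, 3 / 4 < θ ∧ DecayBound signalSource C θ) →
      (∃ C θ : ℝ, 3 / 4 < θ ∧ DecayBound dressedDefect C θ) →
        ∃ C θ : ℝ, 3 / 4 < θ ∧ DecayBound cleanDefect C θ := by
  rintro hRow hAp ⟨c, hcq, hN⟩ ⟨CU, θU, hθU, hU⟩ ⟨CS, θS, hθS, hS⟩ ⟨CD, θD, hθD, hD⟩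
  -- the common rate
  set θ' : ℝ := min θU (min θS θD) with hθ'def
  have hθ' : 3 / 4 < θ' := lt_min hθU (lt_min hθS hθD)
  have hθ'pos : 0 < θ' := by linarith
  have hθ'U : θ' ≤ θU := min_le_left _ _
  have hθ'S : θ' ≤ θS := (min_le_right _ _).trans (min_le_left _ _)
  have hθ'D : θ' ≤ θD := (min_le_right _ _).trans (min_le_right _ _)
  -- the contraction `κ ∈ [1/2, 1)`, `κ ≥ q·max(c,0)/3`
  have hq : 0 ≤ slavingCoupling := slave_coupling_nonneg
  have hc' : 0 ≤ max c 0 := le_max_right _ _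
  have hc'q : slavingCoupling * max c 0 / 3 < 1 := by
    rcases le_total 0 c with h0 | h0
    · rw [max_eq_left h0]
      linarith [mul_comm c slavingCoupling]
    · rw [max_eq_right h0]
      norm_num
  set κ : ℝ := max (slavingCoupling * max c 0 / 3) (1 / 2) with hκdef
  have hκ0 : 0 < κ := lt_of_lt_of_le (by norm_num) (le_max_right _ _)
  have hκ1 : κ < 1 := max_lt hc'q (by norm_num)
  have hκge : slavingCoupling * max c 0 / 3 ≤ κ := le_max_left _ _
  obtain ⟨R₀, hR₀2, hR₀⟩ := slave_ratio hκ0 hκ1 hθ'pos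
  have hR₀pos : 0 < R₀ := by linarith
  -- the constant
  set C' : ℝ := 1 / 3 * |CU| + |CS| + |CD| with hC'def
  have hC'0 : 0 ≤ C' := by positivity
  set K : ℝ := max (2 * C' / (1 - κ)) (R₀ ^ θ' / 2) with hKdef
  have hKR : R₀ ^ θ' / 2 ≤ K := le_max_right _ _
  have hK0 : 0 ≤ K := le_trans (by positivity) hKR
  have hKC : C' + K * ((1 + κ) / 2) ≤ K := by
    have h1 : 2 * C' / (1 - κ) ≤ K := le_max_left _ _
    rw [div_le_iff₀ (by linarith)] at h1
    nlinarith
  refine ⟨K, θ', hθ', ?_⟩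
  -- induction on the number of unit depth layers
  suffices H : ∀ n : ℕ, ∀ Λ : Finset HexVertex, hexDomainSimplyConnected Λ →
      ∀ u w : HexVertex, hexGraph.Adj u w → u ∉ Λ → w ∈ Λ → ∀ (v : HexVertex) (R : ℝ),
        1 ≤ R → R ≤ n → Deep Λ v R → ‖cleanDefect Λ u w v‖ ≤ K * R ^ (-θ') * mass Λ u w v by
    intro Λ hΛ u w huw hu hw v R hR hdeep
    exact H ⌈R⌉₊ Λ hΛ u w huw hu hw v R hR (Nat.le_ceil R) hdeep
  intro n
  induction n with
  | zero =>
    intro Λ _ u w _ _ _ v R hR hRn _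
    push_cast at hRn
    exact absurd (hR.trans hRn) (by norm_num)
  | succ n ih =>
    intro Λ hΛ u w huw hu hw v R hR hRn hdeep
    have hM0 : 0 ≤ mass Λ u w v := mass_nonneg Λ u w v
    have hR0 : 0 < R := by linarith
    have hRθ : 0 ≤ R ^ (-θ') := Real.rpow_nonneg hR0.le _
    rcases lt_or_ge R R₀ with hlt | hge
    · -- below the threshold: the a-priori bound
      have hdeep1 : Deep Λ v 1 := fun y hy => hdeep y (hy.trans hR)
      have hap := hAp Λ u w huw hu hw v hdeep1 (13 / 8)
      have hc := slave_threshold_const hθ'pos hR hlt.le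
      have hK' : R₀ ^ θ' / 2 * R ^ (-θ') ≤ K * R ^ (-θ') := mul_le_mul_of_nonneg_right hKR hRθ
      calc ‖cleanDefect Λ u w v‖ ≤ 1 / 2 * mass Λ u w v := hap
        _ ≤ K * R ^ (-θ') * mass Λ u w v := mul_le_mul_of_nonneg_right (hc.trans hK') hM0
    · -- above the threshold: one step of the row, induction hypothesis at the neighbours
      have hR2 : 2 ≤ R := hR₀2.trans hge
      have hdeep2 : Deep Λ v 2 := fun y hy => hdeep y (hy.trans hR2)
      have hstep := slave_one_step (hRow Λ u w huw hu hw v hdeep2)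
      have hUv := slave_source_mono hR hθ'U hM0 (hU Λ hΛ u w huw hu hw v R hR hdeep)
      have hSv := slave_source_mono hR hθ'S hM0 (hS Λ hΛ u w huw hu hw v R hR hdeep)
      have hDv := slave_source_mono hR hθ'D hM0 (hD Λ hΛ u w huw hu hw v R hR hdeep)
      have hR1θ : 0 ≤ (R - 1) ^ (-θ') := Real.rpow_nonneg (by linarith) _
      have hIH : ∀ t ∈ star Λ v, ‖cleanDefect Λ u w t‖ ≤ K * (R - 1) ^ (-θ') * mass Λ u w t := by
        intro t ht
        have hadj : hexGraph.Adj v t := (Finset.mem_filter.1 ht).2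
        refine ih Λ hΛ u w huw hu hw t (R - 1) (by linarith) ?_ (slave_deep_of_adj hdeep hadj)
        push_cast at hRn
        linarith
      have hsum : ∑ t ∈ star Λ v, ‖cleanDefect Λ u w t‖ ≤
          K * (R - 1) ^ (-θ') * (max c 0 * mass Λ u w v) := by
        calc ∑ t ∈ star Λ v, ‖cleanDefect Λ u w t‖
            ≤ ∑ t ∈ star Λ v, K * (R - 1) ^ (-θ') * mass Λ u w t := Finset.sum_le_sum hIH
          _ = K * (R - 1) ^ (-θ') * ∑ t ∈ star Λ v, mass Λ u w t := by rw [Finset.mul_sum]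
          _ ≤ K * (R - 1) ^ (-θ') * (max c 0 * mass Λ u w v) :=
              mul_le_mul_of_nonneg_left
                ((hN Λ hΛ u w huw hu hw v hdeep2).trans
                  (mul_le_mul_of_nonneg_right (le_max_left _ _) hM0))
                (mul_nonneg hK0 hR1θ)
      have hKM : 0 ≤ K * mass Λ u w v := mul_nonneg hK0 hM0
      have key : slavingCoupling / 3 * ∑ t ∈ star Λ v, ‖cleanDefect Λ u w t‖ ≤
          K * ((1 + κ) / 2) * R ^ (-θ') * mass Λ u w v := by
        calc slavingCoupling / 3 * ∑ t ∈ star Λ v, ‖cleanDefect Λ u w t‖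
            ≤ slavingCoupling / 3 * (K * (R - 1) ^ (-θ') * (max c 0 * mass Λ u w v)) :=
              mul_le_mul_of_nonneg_left hsum (div_nonneg hq (by norm_num))
          _ = slavingCoupling * max c 0 / 3 * (R - 1) ^ (-θ') * (K * mass Λ u w v) := by ring
          _ ≤ κ * (R - 1) ^ (-θ') * (K * mass Λ u w v) :=
              mul_le_mul_of_nonneg_right (mul_le_mul_of_nonneg_right hκge hR1θ) hKM
          _ ≤ (1 + κ) / 2 * R ^ (-θ') * (K * mass Λ u w v) :=
              mul_le_mul_of_nonneg_right (hR₀ R hge) hKM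
          _ = K * ((1 + κ) / 2) * R ^ (-θ') * mass Λ u w v := by ring
      have hRM : 0 ≤ R ^ (-θ') * mass Λ u w v := mul_nonneg hRθ hM0
      calc ‖cleanDefect Λ u w v‖
          ≤ 1 / 3 * ‖unstableSource Λ u w v‖ + ‖signalSource Λ u w v‖ +
              ‖dressedDefect Λ u w v‖ +
              slavingCoupling / 3 * ∑ t ∈ star Λ v, ‖cleanDefect Λ u w t‖ := hstep
        _ ≤ 1 / 3 * (|CU| * R ^ (-θ') * mass Λ u w v) + |CS| * R ^ (-θ') * mass Λ u w v +
              |CD| * R ^ (-θ') * mass Λ u w v + K * ((1 + κ) / 2) * R ^ (-θ') * mass Λ u w v := by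
            linarith
        _ = (C' + K * ((1 + κ) / 2)) * (R ^ (-θ') * mass Λ u w v) := by
            rw [hC'def]
            ring
        _ ≤ K * (R ^ (-θ') * mass Λ u w v) := mul_le_mul_of_nonneg_right hKC hRM
        _ = K * R ^ (-θ') * mass Λ u w v := by ring

end Summit.CriticalPhenomena.SAWScalingLimit.Theorems.DefectDecoherence.SectorSlaving

end
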